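import Summits.KontsevichZagierPeriods.KontsevichZagierPeriods.Theorems.AyoubSpecialisationAssembly
import Literature.NumberTheory.Transcendental.KZProduct
import Literature.NumberTheory.Transcendental.KZKernelConjectureForms

/-!
# The kernel conjecture splits along `[π]`: `KZKernelConjecture ↔ KZ.PiLocalKernel ∧ KZ.PiCancellation`

Pure proof file, route `AyoubSpecialisation` (support for its target stmt-KontsevichZagierPeriods-0538
`AyoubThesisV2` — "the summit is EXACTLY Conjecture 1 for the period ring localised at `[π]` plus
`[π]`-cancellation" — in the closed vocabulary of `Literature/NumberTheory/Transcendental/KZProduct.lean`).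
By-product of siege attempt k8 on the registered stub
`normalFormPrinciple_iff_piLocalKernel_and_piCancellation` of crux stmt-KontsevichZagierPeriods-3869
(route `HurwitzMicroSectors`), which is already discharged in the tree
(`HurwitzMicroSectors.NormalFormPrinciple.PiBox.normalFormPrinciple_iff_piLocalKernel_and_piCancellation`,
file `HurwitzMicroSectorsNormalFormPrinciplePiBoxResidual.lean`) and is therefore NOT restated here
(review of p113269).

Content: the two `π`-localisation statements of `KZProduct.lean` — `KZ.PiLocalKernel` (every formal
combination of value `0` becomes a relation after multiplying by a power of `[π]`; item
stmt-KontsevichZagierPeriods-0541) and `KZ.PiCancellation` (`[π] * c ∈ relations → c ∈ relations`;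
item stmt-KontsevichZagierPeriods-0540) — conjoin EXACTLY to the kernel form of Conjecture 1,
`KZKernelConjecture` (`ker KZ.eval = KZ.relations`), and hence to the summit. Both directions exist in
the tree as implications (`KZ.piLocalKernel_and_piCancellation_of_kernel`, given soundness, in
`KZProduct.lean`; the assembly `kzKernelConjecture_of_piLocalKernel_of_piCancellation` of this
namespace, generalised over the product, in `AyoubSpecialisationAssembly.lean`); this file records the
biconditionals as closed terms:

* `kzKernelConjecture_iff_piLocalKernel_and_piCancellation` :
  `KZKernelConjecture ↔ KZ.PiLocalKernel ∧ KZ.PiCancellation`;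
* `kontsevichZagierPeriods_iff_piLocalKernel_and_piCancellation` :
  `KontsevichZagierPeriods ↔ KZ.PiLocalKernel ∧ KZ.PiCancellation` (through
  `KontsevichZagierPeriods_iff` and `kzKernelConjecture_iff_isRational`).

What is NOT here: the pinned-product packaging of the route file (`AyoubThesisV2` quantifies over a
pinned family `P n r = [π] ⋆ r : IntegralRep (n + 2)`; its existence is item
stmt-KontsevichZagierPeriods-10941 `PiProductRep`), and any claim about `PiLocalKernel` or
`PiCancellation` themselves (open, period-conjecture strength). References: M. Kontsevich,
D. Zagier, *Periods* (2001), §1.2 Conjecture 1, §4.1 (p. 31, `P̂ = P[(2πi)⁻¹]`); J. Ayoub, *Periods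
and the conjectures of Grothendieck and Kontsevich–Zagier*, EMS Newsl. 91 (2014), Def. 6, Conj. 7;
A. Huber, S. Müller-Stach, *Periods and Nori Motives* (2017), Conj. 13.2.1, §13.1.
-/

noncomputable section

open Literature.NumberTheory.Transcendental Literature.NumberTheory.Transcendental.KZ

namespace Summit.KontsevichZagierPeriods.AyoubSpecialisation

/-- **The kernel conjecture splits along `[π]`.**
`KZKernelConjecture ↔ KZ.PiLocalKernel ∧ KZ.PiCancellation`. `→`: exponent `N = 0` for the local
kernel, and `[π] * c ∈ relations ⇒ π · eval c = 0 ⇒ eval c = 0 ⇒ c ∈ relations` for cancellation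
(soundness `relations_le_ker_eval_holds`, `eval_piRep_mul`, `π ≠ 0`), packaged as
`KZ.piLocalKernel_and_piCancellation_of_kernel`. `←`: given `eval c = 0`, `PiLocalKernel` yields
`[π]^N * c ∈ relations` (left-nested iterate) and `PiCancellation` peels the `N` factors one at a
time — an induction on `N`, the landed assembly
`kzKernelConjecture_of_piLocalKernel_of_piCancellation` (this namespace) instantiated at
`mul := KZ.FormalRep.mul`, `p := KZ.of KZ.piRep` (its hypotheses are `PiLocalKernel` and
`PiCancellation` definitionally: `⇑(KZ.FormalRep.mul [π]) = ([π] * ·)` by `rfl`).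
[cite: Ayoub2014, Def. 6 and Conj. 7] -/
theorem kzKernelConjecture_iff_piLocalKernel_and_piCancellation :
    KZKernelConjecture ↔ (PiLocalKernel ∧ PiCancellation) :=
  ⟨piLocalKernel_and_piCancellation_of_kernel relations_le_ker_eval_holds, fun h =>
    kzKernelConjecture_of_piLocalKernel_of_piCancellation FormalRep.mul (of piRep) h.1 h.2⟩

/-- **The summit splits along `[π]`.** `KontsevichZagierPeriods ↔ KZ.PiLocalKernel ∧ KZ.PiCancellation`:
the summit unfolds (`KontsevichZagierPeriods_iff`) to the rational-endpoint two-representation form of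
Conjecture 1, which is the kernel form (`kzKernelConjecture_iff_isRational`), which splits along `[π]`
(`kzKernelConjecture_iff_piLocalKernel_and_piCancellation`). This is the thesis of this route
(stmt-KontsevichZagierPeriods-0538 `AyoubThesisV2`: the summit is EXACTLY "Conjecture 1 for the
period ring localised at `[π]`" plus "`[π]` is a non-zero-divisor modulo relations") as one closed
biconditional, minus the pinned-product packaging. [cite: KontsevichZagier2001, §1.2 Conjecture 1 and §4.1] -/
theorem kontsevichZagierPeriods_iff_piLocalKernel_and_piCancellation :
    KontsevichZagierPeriods ↔ (PiLocalKernel ∧ PiCancellation) :=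
  (KontsevichZagierPeriods_iff.trans kzKernelConjecture_iff_isRational.symm).trans
    kzKernelConjecture_iff_piLocalKernel_and_piCancellation

end Summit.KontsevichZagierPeriods.AyoubSpecialisation

end
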